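import Mathlib
import Literature.RepresentationTheory.FiniteGroups.KLRGradedCellularBasis
import Summits.MatrixMultiplication.MatrixMultiplication.Theorems.SnSubsetDichotomyNoThresholdSubsetTripleSmallWeightTail

/-!
# `SnSubsetDichotomy.NoThresholdSubsetTriple`, line `klr-graded-polynomial-method`:
# stub `pairWindow_of_pairDeviation` (bridge D: two-sided deviation count → window count)

Index set: `i : TableauPair n`, the same-shape pairs `(μ, S, T)` of standard tableaux with `n`
cells. Write `X i = TableauPair.degree 2 i = deg₂ S + deg₂ T` and `w i = c₀ − (c₀ − c₁)²` with
`cⱼ = TableauPair.content 2 i j` (the `2`-block weight of the shape).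

The slice-rank step of the line consumes the WINDOW count
`2·#{X < a} + #{2a ≤ X}` with the cut `a = ⌊(2w+2)/3⌋ = ⌈2w/3⌉`; this file derives its bound
`≤ n!·e^{-c√n}` from the two-sided DEVIATION count `#{n ≤ 100·|X − w|} ≤ n!·e^{-c₁√n}` and the
tree theorem `smallWeightTail` (`#{32w < n} ≤ n!·e^{-c₂√n}`).

Arithmetic (integers, `n ≤ 32w`): `X < a` gives `3X ≤ 2w − 1`, so `300(w − X) ≥ 100w + 100 ≥ 3n`;
`2a ≤ X` gives `3X ≥ 6a ≥ 4w`, so `300(X − w) ≥ 100w ≥ 3n`. Hence both window events lie in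
`{n ≤ 100|X − w|} ∪ {32w < n}`, the window count is `≤ 3·(#dev + #small) ≤ 6·n!e^{-c√n}` for
`c = min c₁ c₂`, and `6·n!e^{-c√n} ≤ n!e^{-(c/2)√n}` once `6 ≤ e^{(c/2)√n}`.
-/

namespace Summit.MatrixMultiplication.MatrixMultiplication.Theorems

open Literature.RepresentationTheory.FiniteGroups (TableauPair KLRGradedCellularBasis residueContent tableauDegree)

namespace KlrLine

/-- **The counting step deviation ⟹ window** on a finite index type, for integer-valued `X`
("degree"), `w` ("weight") and a threshold `m` ("`n`"): with the cut `a = ⌊(2w+2)/3⌋`,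
`2·#{X < a} + #{2a ≤ X} ≤ 3·(#{m ≤ 100|X − w|} + #{32w < m})`.
Pointwise: if `m ≤ 32w` then `X < a` forces `3X ≤ 2w − 1` and `m ≤ 100(w − X)`, while
`2a ≤ X` forces `3X ≥ 4w` and `m ≤ 100(X − w)`; then
`#(P ∨ Q) ≤ #P + #Q`. [folklore] -/
private theorem two_mul_card_add_card_le_three {α : Type*} [Finite α] (X w : α → ℤ) (m : ℤ) :
    2 * Nat.card {i // X i < (2 * w i + 2) / 3} +
        Nat.card {i // 2 * ((2 * w i + 2) / 3) ≤ X i} ≤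
      3 * (Nat.card {i // m ≤ 100 * |X i - w i|} + Nat.card {i // 32 * w i < m}) := by
  classical
  haveI := Fintype.ofFinite α
  have hor : Fintype.card {i // m ≤ 100 * |X i - w i| ∨ 32 * w i < m} ≤
      Fintype.card {i // m ≤ 100 * |X i - w i|} + Fintype.card {i // 32 * w i < m} :=
    Fintype.card_subtype_or _ _
  have h1 : Fintype.card {i // X i < (2 * w i + 2) / 3} ≤
      Fintype.card {i // m ≤ 100 * |X i - w i| ∨ 32 * w i < m} :=
    Fintype.card_subtype_mono _ _ fun i hi => by
      have h₁ := le_abs_self (X i - w i)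
      have h₂ := neg_le_abs (X i - w i)
      omega
  have h2 : Fintype.card {i // 2 * ((2 * w i + 2) / 3) ≤ X i} ≤
      Fintype.card {i // m ≤ 100 * |X i - w i| ∨ 32 * w i < m} :=
    Fintype.card_subtype_mono _ _ fun i hi => by
      have h₁ := le_abs_self (X i - w i)
      have h₂ := neg_le_abs (X i - w i)
      omega
  simp only [Nat.card_eq_fintype_card]
  omega

/-- Beyond some `n₁`, `6 ≤ e^{(c/2)√n}` (`n₁ = ⌈(2 log 6 / c)²⌉`). [folklore] -/
private theorem exists_six_le_exp {c : ℝ} (hc : 0 < c) :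
    ∃ n₁ : ℕ, ∀ n : ℕ, n₁ ≤ n → (6 : ℝ) ≤ Real.exp (c / 2 * Real.sqrt (n : ℝ)) := by
  refine ⟨⌈(2 * Real.log 6 / c) ^ 2⌉₊, fun n hn => ?_⟩
  have hn' : (2 * Real.log 6 / c) ^ 2 ≤ (n : ℝ) := (Nat.le_ceil _).trans (by exact_mod_cast hn)
  have h0 : 0 ≤ 2 * Real.log 6 / c := by
    have : 0 ≤ Real.log 6 := Real.log_nonneg (by norm_num)
    positivity
  have hsq : 2 * Real.log 6 / c ≤ Real.sqrt (n : ℝ) := by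
    rw [← Real.sqrt_sq h0]
    exact Real.sqrt_le_sqrt hn'
  have hlog : Real.log 6 ≤ c / 2 * Real.sqrt (n : ℝ) := by
    have := mul_le_mul_of_nonneg_left hsq (le_of_lt (half_pos hc))
    calc Real.log 6 = c / 2 * (2 * Real.log 6 / c) := by field_simp
      _ ≤ c / 2 * Real.sqrt (n : ℝ) := this
  calc (6 : ℝ) = Real.exp (Real.log 6) := (Real.exp_log (by norm_num)).symm
    _ ≤ Real.exp (c / 2 * Real.sqrt (n : ℝ)) := Real.exp_le_exp.2 hlog

end KlrLine

set_option linter.dupNamespace false in -- deliberate Summit.<S>.<P> duplicate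
open KlrLine in
/-- **Stub `pairWindow_of_pairDeviation` (line `klr-graded-polynomial-method`, crux
`SnSubsetDichotomy.NoThresholdSubsetTriple`, stmt-MatrixMultiplication-8302): bridge D, the
two-sided deviation count controls the window count.** With `X = deg₂ S + deg₂ T`,
`w = c₀ − (c₀ − c₁)²` the `2`-block weight and the cut `a = ⌊(2w+2)/3⌋ = ⌈2w/3⌉`: if
`#{(μ, S, T) : n ≤ 100·|X − w|} ≤ n!·e^{-c√n}` for large `n`, then
`2·#{X < a} + #{2a ≤ X} ≤ n!·e^{-c'√n}` for large `n`. Proof: for `n ≤ 32w` both window events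
force `n ≤ 100|X − w|` (`two_mul_card_add_card_le_three`), the complementary regime `32w < n` is
counted by `smallWeightTail`, and `6·n!e^{-c√n} ≤ n!e^{-(c/2)√n}` once `6 ≤ e^{(c/2)√n}`
(`c = min c₁ c₂`). [folklore] -/
theorem pairWindow_of_pairDeviation : (∃ c : ℝ, 0 < c ∧ ∃ n₀ : ℕ, ∀ n ≥ n₀, (Nat.card {i : TableauPair n // (n : ℤ) ≤ 100 * |TableauPair.degree 2 i - ((TableauPair.content 2 i 0 : ℤ) - ((TableauPair.content 2 i 0 : ℤ) - (TableauPair.content 2 i 1 : ℤ)) ^ 2)|} : ℝ) ≤ (n.factorial : ℝ) * Real.exp (-(c * Real.sqrt (n : ℝ)))) → (∃ c : ℝ, 0 < c ∧ ∃ n₀ : ℕ, ∀ n ≥ n₀, ((2 * Nat.card {i : TableauPair n // TableauPair.degree 2 i < (2 * ((TableauPair.content 2 i 0 : ℤ) - ((TableauPair.content 2 i 0 : ℤ) - (TableauPair.content 2 i 1 : ℤ)) ^ 2) + 2) / 3} + Nat.card {i : TableauPair n // 2 * ((2 * ((TableauPair.content 2 i 0 : ℤ) - ((TableauPair.content 2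 i 0 : ℤ) - (TableauPair.content 2 i 1 : ℤ)) ^ 2) + 2) / 3) ≤ TableauPair.degree 2 i} : ℕ) : ℝ) ≤ (n.factorial : ℝ) * Real.exp (-(c * Real.sqrt (n : ℝ)))) := by
  rintro ⟨c₁, hc₁, n₁, hD⟩
  obtain ⟨c₂, hc₂, n₂, hS⟩ := smallWeightTail
  obtain ⟨c, hc, hcle₁, hcle₂⟩ : ∃ c : ℝ, 0 < c ∧ c ≤ c₁ ∧ c ≤ c₂ :=
    ⟨min c₁ c₂, lt_min hc₁ hc₂, min_le_left _ _, min_le_right _ _⟩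
  obtain ⟨n₃, hn₃⟩ := exists_six_le_exp hc
  refine ⟨c / 2, half_pos hc, max (max n₁ n₂) n₃, fun n hn => ?_⟩
  have hn₁ : n₁ ≤ n := ((le_max_left _ _).trans (le_max_left _ _)).trans hn
  have hn₂ : n₂ ≤ n := ((le_max_right _ _).trans (le_max_left _ _)).trans hn
  have h6 := hn₃ n ((le_max_right _ _).trans hn)
  -- the counting step, cast to `ℝ`
  have hcount := two_mul_card_add_card_le_three
    (fun i : TableauPair n => TableauPair.degree 2 i)
    (fun i : TableauPair n => (TableauPair.content 2 i 0 : ℤ) -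
      ((TableauPair.content 2 i 0 : ℤ) - (TableauPair.content 2 i 1 : ℤ)) ^ 2) (n : ℤ)
  have hR := Nat.cast_le (α := ℝ) |>.2 hcount
  refine hR.trans ?_
  push_cast
  -- constants: `3·(n!e^{-c₁√n} + n!e^{-c₂√n}) ≤ 6·n!e^{-c√n} ≤ n!e^{-(c/2)√n}`
  have hf0 : (0 : ℝ) ≤ (n.factorial : ℝ) := Nat.cast_nonneg _
  have hf : (0 : ℝ) ≤ (n.factorial : ℝ) * Real.exp (-(c * Real.sqrt (n : ℝ))) := by positivity
  have hDc : (Nat.card {i : TableauPair n // (n : ℤ) ≤ 100 * |TableauPair.degree 2 i -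
      ((TableauPair.content 2 i 0 : ℤ) - ((TableauPair.content 2 i 0 : ℤ) -
        (TableauPair.content 2 i 1 : ℤ)) ^ 2)|} : ℝ) ≤
      (n.factorial : ℝ) * Real.exp (-(c * Real.sqrt (n : ℝ))) :=
    (hD n hn₁).trans (mul_le_mul_of_nonneg_left (Real.exp_le_exp.2
      (neg_le_neg (mul_le_mul_of_nonneg_right hcle₁ (Real.sqrt_nonneg _)))) hf0)
  have hSc : (Nat.card {i : TableauPair n // 32 * ((TableauPair.content 2 i 0 : ℤ) -
      ((TableauPair.content 2 i 0 : ℤ) - (TableauPair.content 2 i 1 : ℤ)) ^ 2) < (n : ℤ)} : ℝ) ≤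
      (n.factorial : ℝ) * Real.exp (-(c * Real.sqrt (n : ℝ))) :=
    (hS n hn₂).trans (mul_le_mul_of_nonneg_left (Real.exp_le_exp.2
      (neg_le_neg (mul_le_mul_of_nonneg_right hcle₂ (Real.sqrt_nonneg _)))) hf0)
  have hEF : 6 * ((n.factorial : ℝ) * Real.exp (-(c * Real.sqrt (n : ℝ)))) ≤
      Real.exp (c / 2 * Real.sqrt (n : ℝ)) *
        ((n.factorial : ℝ) * Real.exp (-(c * Real.sqrt (n : ℝ)))) :=
    mul_le_mul_of_nonneg_right h6 hf
  have key : Real.exp (c / 2 * Real.sqrt (n : ℝ)) *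
        ((n.factorial : ℝ) * Real.exp (-(c * Real.sqrt (n : ℝ)))) =
      (n.factorial : ℝ) * Real.exp (-(c / 2 * Real.sqrt (n : ℝ))) := by
    rw [mul_left_comm, ← Real.exp_add]
    congr 1
    ring_nf
  linarith [hDc, hSc, hEF, key]

end Summit.MatrixMultiplication.MatrixMultiplication.Theorems
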